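import Mathlib
import Summits.PneNP.PneNP.Theorems.Nc03AvoidResidualCoreReductionLinA

/-!
# Route Nc03AvoidResidualCore, item `ResidualCoreReduction` — the `MUX` class, I: the rigidity certificate

Helper file for `stmt-PneNP-20227` (residual-core reduction of `NC⁰₃-AVOID` at linear stretch; cell
pnp-ideate, dossier HOME/pnp-ideate-p2/ROUND-3-ADDENDUM-A.md, Theorem A.2 "balanced colourings are
rigid"). For a PURE `MUX` instance (`rep 12 = muxPred`: output `j` reads a selector `s_j` (role `0`),
a `1`-datum `a_j` (role `1`) and a `0`-datum `b_j` (role `2`) and shows `s_j ? a_j : b_j`) we prove the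
SOUNDNESS of the rigidity certificate, in a linear-algebra form slightly more general than Addendum A
(no disjointness of the data sides is needed):

* Let `E` be a set of outputs on which the pattern `y` is EXACTLY BALANCED — at every variable `v`,
  among the outputs of `E` with `1`-datum `v` as many show `1` as `0`, and likewise for `0`-data.
  If `y` is attained by `x`, the tight counting of Addendum A forces `x_{a_j} ≠ x_{b_j}` and hence
  `y_j = x_{b_j} ⊕ x_{s_j}` for every `j ∈ E` (`mux_rigid`): on `E` the pattern is an `𝔽₂`-LINEAR
  function of the assignment.
* Consequently (`cert12_sound`): if the augmented rows `(e_{s_j} + e_{b_j} ∣ y_j)`, `j ∈ E`, span the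
  vector `(0 ∣ 1)` — i.e. the linear system `x_{s_j} + x_{b_j} = y_j (j ∈ E)` is inconsistent, a rank
  test — then `y` is outside the range.

The existence of such `(E, y)` at linear stretch (Addendum A §A.3: Eulerian sub-multigraph, a
fundamental cycle outside the image, alternating colouring along a transition system) is the sequel.
[folklore; ROUND-3 Addendum A, Thm A.2]
-/

set_option linter.dupNamespace false -- `Summit.PneNP.PneNP.…`: summit = sub-problem name (D-0017 single-conjunct layout)

namespace Summit.PneNP.PneNP.Theorems.Nc03Reduction

open Finset Literature.Computability.Complexity

variable {N M : ℕ}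

/-! ## Augmented vectors: one extra coordinate for the right-hand side -/

/-- Vectors of `𝔽₂^{N+1}`, the extra coordinate being `none`. -/
abbrev AVec (N : ℕ) := Option (Fin N) → ZMod 2

/-- The augmented vector `(ρ ∣ t)`. -/
def aug (ρ : Vec N) (t : ZMod 2) : AVec N := fun o => o.elim t ρ

/-- The target `(0 ∣ 1)`: it lies in the span of the augmented rows of a linear system iff the system
is inconsistent. -/
def tgt (N : ℕ) : AVec N := fun o => o.elim 1 (fun _ => 0)

/-- A vector orthogonal to a set is orthogonal to its span (any finite index type). -/
theorem dot_eq_zero_of_mem_span' {ι : Type*} [Fintype ι] (a : ι → ZMod 2) {S : Set (ι → ZMod 2)}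
    (hS : ∀ s ∈ S, a ⬝ᵥ s = 0) {v : ι → ZMod 2} (hv : v ∈ Submodule.span (ZMod 2) S) :
    a ⬝ᵥ v = 0 := by
  induction hv using Submodule.span_induction with
  | mem s hs => exact hS s hs
  | zero => simp
  | add u w _ _ hu hw => rw [dotProduct_add, hu, hw, add_zero]
  | smul c u _ hu => rw [dotProduct_smul, hu, smul_zero]

/-- Pairing an augmented assignment `(χ x ∣ 1)` with an augmented row. -/
theorem aug_dot (x : Fin N → Bool) (ρ : Vec N) (t : ZMod 2) :
    aug (chi x) 1 ⬝ᵥ aug ρ t = t + chi x ⬝ᵥ ρ := by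
  simp [dotProduct, aug, Fintype.sum_option]

/-- Pairing `(χ x ∣ 1)` with the target gives `1`. -/
theorem aug_dot_tgt (x : Fin N → Bool) : aug (chi x) 1 ⬝ᵥ tgt N = 1 := by
  simp [dotProduct, aug, tgt, Fintype.sum_option]

/-! ## The tight counting -/

/-- The `MUX` bit: `s ? a : b`. -/
theorem rep12_eq (u : Fin 3 → Bool) : rep 12 u = (if u 0 then u 1 else u 2) := rfl

/-- Summing a balanced count over the fibres of the data map: the number of outputs of `E` (with data
map `d`) whose bit equals the value of their datum is the number of outputs showing `1`. -/
theorem card_match_eq (E : Finset (Fin M)) (d : Fin M → Fin N) (y x' : Fin M → Bool) (x : Fin N → Bool)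
    (hx' : ∀ j, x' j = x (d j))
    (hbal : ∀ v, (E.filter fun j => d j = v ∧ y j = true).card =
      (E.filter fun j => d j = v ∧ y j = false).card) :
    (E.filter fun j => y j = x' j).card = (E.filter fun j => y j = true).card := by
  classical
  rw [Finset.card_eq_sum_card_fiberwise (f := d) (t := Finset.univ) (fun _ _ => Finset.mem_univ _),
    Finset.card_eq_sum_card_fiberwise (f := d) (t := Finset.univ) (s := E.filter fun j => y j = true)
      (fun _ _ => Finset.mem_univ _)]
  refine Finset.sum_congr rfl fun v _ => ?_
  have e1 : ((E.filter fun j => y j = x' j).filter fun j => d j = v) =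
      E.filter fun j => d j = v ∧ y j = x v := by
    ext j
    simp only [Finset.mem_filter, hx' j]
    constructor
    · rintro ⟨⟨hj, hy⟩, hd⟩; exact ⟨hj, hd, by rw [hy, hd]⟩
    · rintro ⟨hj, hd, hy⟩; exact ⟨⟨hj, by rw [hy, hd]⟩, hd⟩
  have e2 : ((E.filter fun j => y j = true).filter fun j => d j = v) =
      E.filter fun j => d j = v ∧ y j = true := by
    ext j; simp only [Finset.mem_filter]; tauto
  rw [e1, e2]
  cases x v
  · exact (hbal v).symm
  · rfl

/-- **Rigidity** (Addendum A, Thm A.2, linear form): on an exactly balanced set of outputs an attained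
`MUX` pattern is the linear function `y_j = x_{b_j} ⊕ x_{s_j}`. -/
theorem mux_rigid {I : LocalMap 3 N M} (hP : I.IsPure (rep 12)) (E : Finset (Fin M))
    {y : Fin M → Bool}
    (hA : ∀ v, (E.filter fun j => I.vars j 1 = v ∧ y j = true).card =
      (E.filter fun j => I.vars j 1 = v ∧ y j = false).card)
    (hB : ∀ v, (E.filter fun j => I.vars j 2 = v ∧ y j = true).card =
      (E.filter fun j => I.vars j 2 = v ∧ y j = false).card)
    {x : Fin N → Bool} (hx : I.eval x = y) :
    ∀ j ∈ E, y j = xor (x (I.vars j 2)) (x (I.vars j 0)) := by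
  classical
  have hev : ∀ j, y j = (if x (I.vars j 0) then x (I.vars j 1) else x (I.vars j 2)) := by
    intro j; rw [← hx, eval_of_isPure hP, rep12_eq]
  set EX := E.filter fun j => x (I.vars j 0) = true with hEX
  set EX' := E.filter fun j => x (I.vars j 0) = false with hEX'
  set MA := E.filter fun j => y j = x (I.vars j 1) with hMA
  set MB := E.filter fun j => y j = x (I.vars j 2) with hMB
  have h1 : EX ⊆ MA := by
    intro j hj
    simp only [hEX, hMA, Finset.mem_filter] at hj ⊢
    exact ⟨hj.1, by rw [hev j, hj.2]; rfl⟩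
  have h2 : EX' ⊆ MB := by
    intro j hj
    simp only [hEX', hMB, Finset.mem_filter] at hj ⊢
    exact ⟨hj.1, by rw [hev j, hj.2]; rfl⟩
  -- the matching sets have exactly half of `E`
  set m1 := (E.filter fun j => y j = true).card with hm1
  set m0 := (E.filter fun j => y j = false).card with hm0
  have hMA1 : MA.card = m1 :=
    card_match_eq E (fun j => I.vars j 1) y (fun j => x (I.vars j 1)) x (fun _ => rfl) hA
  have hMB1 : MB.card = m1 :=
    card_match_eq E (fun j => I.vars j 2) y (fun j => x (I.vars j 2)) x (fun _ => rfl) hB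
  have hsum : m1 + m0 = E.card := by
    rw [hm1, hm0]
    have := Finset.card_filter_add_card_filter_not (s := E) (fun j => y j = true)
    simpa using this
  have h10 : m1 = m0 := by
    rw [hm1, hm0,
      Finset.card_eq_sum_card_fiberwise (f := fun j => I.vars j 1) (t := Finset.univ)
        (fun _ _ => Finset.mem_univ _),
      Finset.card_eq_sum_card_fiberwise (f := fun j => I.vars j 1) (t := Finset.univ)
        (s := E.filter fun j => y j = false) (fun _ _ => Finset.mem_univ _)]
    refine Finset.sum_congr rfl fun v _ => ?_
    have e1 : ((E.filter fun j => y j = true).filter fun j => I.vars j 1 = v) =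
        E.filter fun j => I.vars j 1 = v ∧ y j = true := by
      ext j; simp only [Finset.mem_filter]; tauto
    have e2 : ((E.filter fun j => y j = false).filter fun j => I.vars j 1 = v) =
        E.filter fun j => I.vars j 1 = v ∧ y j = false := by
      ext j; simp only [Finset.mem_filter]; tauto
    rw [e1, e2]; exact hA v
  have hsplit : EX.card + EX'.card = E.card := by
    rw [hEX, hEX']
    have := Finset.card_filter_add_card_filter_not (s := E) (fun j => x (I.vars j 0) = true)
    simpa using this
  have hc1 := Finset.card_le_card h1
  have hc2 := Finset.card_le_card h2
  have heq1 : EX = MA := Finset.eq_of_subset_of_card_le h1 (by omega)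
  have heq2 : EX' = MB := Finset.eq_of_subset_of_card_le h2 (by omega)
  intro j hj
  cases hs : x (I.vars j 0)
  · -- selector off: `j ∈ MB`, `j ∉ MA`
    have hjB : j ∈ MB := by rw [← heq2]; simp [hEX', hj, hs]
    simp only [hMB, Finset.mem_filter] at hjB
    rw [hjB.2]; simp
  · -- selector on: `j ∈ MA`, `j ∉ MB`
    have hjA : j ∈ MA := by rw [← heq1]; simp [hEX, hj, hs]
    have hjB : j ∉ MB := by rw [← heq2]; simp [hEX', hs]
    simp only [hMA, hMB, Finset.mem_filter, not_and] at hjA hjB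
    have hne := hjB hj
    rw [hjA.2] at hne ⊢
    revert hne
    cases x (I.vars j 1) <;> cases x (I.vars j 2) <;> simp

/-- The augmented row of a `MUX` output: `(e_{s_j} + e_{b_j} ∣ y_j)`. -/
def arow (I : LocalMap 3 N M) (y : Fin M → Bool) (j : Fin M) : AVec N :=
  aug (ind (I.vars j 0) + ind (I.vars j 2)) (bit (y j))

/-- **Soundness, class `12` (`MUX`, rigidity certificate).** If `y` is exactly balanced on `E` (at every
`1`-datum and every `0`-datum) and the linear system `x_{s_j} + x_{b_j} = y_j (j ∈ E)` is inconsistent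
— the target `(0 ∣ 1)` lies in the span of the augmented rows — then `y` is never attained.
[ROUND-3 Addendum A, Thm A.2 + linear algebra] -/
theorem cert12_sound {I : LocalMap 3 N M} (hP : I.IsPure (rep 12)) (E : Finset (Fin M))
    {y : Fin M → Bool}
    (hA : ∀ v, (E.filter fun j => I.vars j 1 = v ∧ y j = true).card =
      (E.filter fun j => I.vars j 1 = v ∧ y j = false).card)
    (hB : ∀ v, (E.filter fun j => I.vars j 2 = v ∧ y j = true).card =
      (E.filter fun j => I.vars j 2 = v ∧ y j = false).card)
    (hout : tgt N ∈ Submodule.span (ZMod 2) (arow I y '' ↑E)) : y ∉ I.range := by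
  rintro ⟨x, hx⟩
  have hlin := mux_rigid hP E hA hB hx
  have horth : ∀ s ∈ arow I y '' ↑E, aug (chi x) 1 ⬝ᵥ s = 0 := by
    rintro s ⟨j, hj, rfl⟩
    rw [arow, aug_dot, chi_dot_pair, hlin j hj, bit_add]
    -- `y_j + (b ⊕ s) = 0` with `y_j = b ⊕ s`
    rw [bit_eq_zero]
    cases x (I.vars j 2) <;> cases x (I.vars j 0) <;> rfl
  have h0 := dot_eq_zero_of_mem_span' (aug (chi x) 1) horth hout
  rw [aug_dot_tgt] at h0
  exact one_ne_zero h0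

end Summit.PneNP.PneNP.Theorems.Nc03Reduction
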